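import Summits.Ventures.Crystal3D.Theorems.StickyWulffConstantPolycrystalWulffBoundTwoClassArith

/-!
# `PolycrystalWulffBound`, line `PolyDensity`: arithmetic helpers for the middle-band BOX certificates

Route `StickyWulffConstant` of the venture `Summits/Ventures/Crystal3D`, crux `PolycrystalWulffBound`
(item `stmt-Ventures-19482`), second prover lane (poly-p2, gen 4).  The typed m-class certificates
(HOME/poly-p2/BOXCERT3-27.80-tau0.0008.txt; MIDDLE-BAND-g4.md §8′) verify, box by box in the class-fraction
chart, that a fixed nonnegative combination of LP rows `g(v) = Σ_r y_r·c_r·(ℓ_r(v))^{2/3}` (`ℓ_r` affine in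
the class volumes) dominates `κ′·V^{2/3}`.  Three generic steps, proved once here:

* `rpow_twoThirds_lb` — rational lower bounds for the atoms: `q³ ≤ 27·K·t²` ⇒ `q ≤ 3·K^{1/3}·t^{2/3}`;
* `jensen4_rpow_twoThirds` — four-point Jensen for `u ↦ u^{2/3}` (the atoms are concave in `v`);
* `bilinear_weights` — every point of a box is the bilinear convex combination of its corners.
WHAT THIS IS NOT: any certificate; F-C1 not moved.
-/

noncomputable section

namespace Summit.Ventures.Crystal3D.Theorems

open Real Finset

/-- Rational lower bounds for the LP atoms: `0 ≤ q`, `q³ ≤ 27·K·t²` ⇒ `q ≤ 3·K^{1/3}·t^{2/3}`. -/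
theorem rpow_twoThirds_lb {q K t : ℝ} (hq : 0 ≤ q) (hK : 0 ≤ K) (ht : 0 ≤ t)
    (h : q ^ 3 ≤ 27 * K * t ^ 2) : q ≤ 3 * K ^ ((1 : ℝ) / 3) * t ^ ((2 : ℝ) / 3) := by
  have h1 : q ≤ (27 * K * t ^ 2) ^ ((1 : ℝ) / 3) := le_rpow_third_of_cube_le hq h
  have h27 : (27 : ℝ) ^ ((1 : ℝ) / 3) = 3 := by
    rw [show (27 : ℝ) = 3 ^ (3 : ℝ) by norm_num, ← Real.rpow_mul (by norm_num)]
    norm_num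
  have ht2 : (t ^ 2) ^ ((1 : ℝ) / 3) = t ^ ((2 : ℝ) / 3) := by
    rw [show t ^ 2 = t ^ (2 : ℝ) by norm_cast, ← Real.rpow_mul ht]
    norm_num
  rw [Real.mul_rpow (by positivity) (by positivity), Real.mul_rpow (by norm_num) hK, h27, ht2] at h1
  exact h1

/-- Four-point Jensen for `u ↦ u^{2/3}`: `Σ w_c·u_c^{2/3} ≤ (Σ w_c·u_c)^{2/3}` for nonnegative weights
summing to `1` and nonnegative `u_c`. -/
theorem jensen4_rpow_twoThirds {w₁ w₂ w₃ w₄ u₁ u₂ u₃ u₄ : ℝ} (h₁ : 0 ≤ w₁) (h₂ : 0 ≤ w₂) (h₃ : 0 ≤ w₃)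
    (h₄ : 0 ≤ w₄) (hsum : w₁ + w₂ + w₃ + w₄ = 1) (hu₁ : 0 ≤ u₁) (hu₂ : 0 ≤ u₂) (hu₃ : 0 ≤ u₃)
    (hu₄ : 0 ≤ u₄) :
    w₁ * u₁ ^ ((2 : ℝ) / 3) + w₂ * u₂ ^ ((2 : ℝ) / 3) + w₃ * u₃ ^ ((2 : ℝ) / 3) + w₄ * u₄ ^ ((2 : ℝ) / 3) ≤
      (w₁ * u₁ + w₂ * u₂ + w₃ * u₃ + w₄ * u₄) ^ ((2 : ℝ) / 3) := by
  have hconc := Real.concaveOn_rpow (p := (2 : ℝ) / 3) (by norm_num) (by norm_num)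
  set w : Fin 4 → ℝ := ![w₁, w₂, w₃, w₄] with hw
  set u : Fin 4 → ℝ := ![u₁, u₂, u₃, u₄] with hu
  have hw0 : ∀ i ∈ (univ : Finset (Fin 4)), 0 ≤ w i := by
    intro i _; fin_cases i <;> simp [hw, h₁, h₂, h₃, h₄]
  have hw1 : ∑ i, w i = 1 := by simp [hw, Fin.sum_univ_four, hsum]
  have hmem : ∀ i ∈ (univ : Finset (Fin 4)), u i ∈ Set.Ici (0 : ℝ) := by
    intro i _; fin_cases i <;> simp [hu, hu₁, hu₂, hu₃, hu₄]
  have h := hconc.le_map_sum hw0 hw1 hmem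
  simp only [smul_eq_mul, Fin.sum_univ_four, hw, hu, Matrix.cons_val_zero, Matrix.cons_val_one,
    Matrix.head_cons, Matrix.cons_val_two, Matrix.tail_cons, Matrix.cons_val_three] at h
  convert h using 2

/-- Bilinear weights: a point of the box `[a₁,b₁] × [a₃,b₃]` is the convex combination of the four corners
`(a₁,a₃), (a₁,b₃), (b₁,a₃), (b₁,b₃)` with weights `w₁..w₄ ≥ 0`, `Σ w = 1`. -/
theorem bilinear_weights {a₁ b₁ a₃ b₃ s t : ℝ} (hab₁ : a₁ < b₁) (hab₃ : a₃ < b₃)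
    (hs₁ : a₁ ≤ s) (hs₂ : s ≤ b₁) (ht₁ : a₃ ≤ t) (ht₂ : t ≤ b₃) :
    ∃ w₁ w₂ w₃ w₄ : ℝ, 0 ≤ w₁ ∧ 0 ≤ w₂ ∧ 0 ≤ w₃ ∧ 0 ≤ w₄ ∧ w₁ + w₂ + w₃ + w₄ = 1 ∧
      w₁ * a₁ + w₂ * a₁ + w₃ * b₁ + w₄ * b₁ = s ∧ w₁ * a₃ + w₂ * b₃ + w₃ * a₃ + w₄ * b₃ = t := by
  have hd₁ : 0 < b₁ - a₁ := sub_pos.2 hab₁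
  have hd₃ : 0 < b₃ - a₃ := sub_pos.2 hab₃
  have hD : 0 < (b₁ - a₁) * (b₃ - a₃) := mul_pos hd₁ hd₃
  refine ⟨(b₁ - s) * (b₃ - t) / ((b₁ - a₁) * (b₃ - a₃)), (b₁ - s) * (t - a₃) / ((b₁ - a₁) * (b₃ - a₃)),
    (s - a₁) * (b₃ - t) / ((b₁ - a₁) * (b₃ - a₃)), (s - a₁) * (t - a₃) / ((b₁ - a₁) * (b₃ - a₃)),
    div_nonneg (mul_nonneg (by linarith) (by linarith)) hD.le,
    div_nonneg (mul_nonneg (by linarith) (by linarith)) hD.le,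
    div_nonneg (mul_nonneg (by linarith) (by linarith)) hD.le,
    div_nonneg (mul_nonneg (by linarith) (by linarith)) hD.le, ?_, ?_, ?_⟩
  · field_simp; ring
  · field_simp; ring
  · field_simp; ring

/-- Corner combination: if `g ≥ Σ w_c·L_c` with weights `w_c ≥ 0` summing to `1` and each `L_c ≥ m`,
then `g ≥ m`. -/
theorem ge_of_corner_bounds {g w₁ w₂ w₃ w₄ L₁ L₂ L₃ L₄ m : ℝ} (h₁ : 0 ≤ w₁) (h₂ : 0 ≤ w₂) (h₃ : 0 ≤ w₃)
    (h₄ : 0 ≤ w₄) (hsum : w₁ + w₂ + w₃ + w₄ = 1) (hg : w₁ * L₁ + w₂ * L₂ + w₃ * L₃ + w₄ * L₄ ≤ g)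
    (hL₁ : m ≤ L₁) (hL₂ : m ≤ L₂) (hL₃ : m ≤ L₃) (hL₄ : m ≤ L₄) : m ≤ g := by
  have k₁ := mul_nonneg h₁ (sub_nonneg.2 hL₁)
  have k₂ := mul_nonneg h₂ (sub_nonneg.2 hL₂)
  have k₃ := mul_nonneg h₃ (sub_nonneg.2 hL₃)
  have k₄ := mul_nonneg h₄ (sub_nonneg.2 hL₄)
  have hm : m = (w₁ + w₂ + w₃ + w₄) * m := by rw [hsum, one_mul]
  have key : (w₁ + w₂ + w₃ + w₄) * m ≤ w₁ * L₁ + w₂ * L₂ + w₃ * L₃ + w₄ * L₄ := by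
    have e : w₁ * L₁ + w₂ * L₂ + w₃ * L₃ + w₄ * L₄ - (w₁ + w₂ + w₃ + w₄) * m =
        w₁ * (L₁ - m) + w₂ * (L₂ - m) + w₃ * (L₃ - m) + w₄ * (L₄ - m) := by ring
    linarith
  linarith

/-- The single-crystal constant from above: `6·2^{1/3}(√2 V)^{2/3} ≤ 9.5246·V^{2/3}`. -/
theorem wulffConstant_le {V : ℝ} (hV : 0 ≤ V) :
    6 * (2 : ℝ) ^ ((1 : ℝ) / 3) * (Real.sqrt 2 * V) ^ ((2 : ℝ) / 3) ≤ 9.5246 * V ^ ((2 : ℝ) / 3) := by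
  rw [wulffConstant_eq' hV]
  have h := cbrt_two_bounds.2.1
  have h0 : 0 ≤ (2 : ℝ) ^ ((1 : ℝ) / 3) := by positivity
  have hV' : 0 ≤ V ^ ((2 : ℝ) / 3) := by positivity
  nlinarith [mul_nonneg hV' (sub_nonneg.2 h)]

end Summit.Ventures.Crystal3D.Theorems

end
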